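import Mathlib
import HarnessLib

/-!
# `RegularTwistCM` (stmt-Langlands-14069) — negative lane III: the unitary mirror, cuspidality, and
the `GL(1)` square-root / angular levers (cycle 3, `--supports`)

Sorry-free lemmas from §6 of the standing disprover's workfile
`Summits/Langlands/Langlands/Cruxes/RegularTwistCM/Disproof.lean` (cycle 3), landed so that the lead and
the planners of the three filed lines (`Cruxes/RegularTwistCM/Lines/{multiset-purity-parity,
unimodular-normal-form, unitary-mirror-parity}.lean`) may import them.

* `mirror_glOne_iff`, `mirror_glOne_of_pairing` — at `n = 1` the "unitary mirror"
  `P(ῑ) = {-z̄ + c : z ∈ P(ι)}` of line `unitary-mirror-parity` is EXACTLY `Im p = Im q`, which the pairing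
  `p - q ∈ ℤ` of a character `z^p z̄^q` of `ℂˣ` gives for free (so the lever has content only for `n ≥ 2`
  and in the uniformity of `c`).
* `mirror_offAxis_obstructed` / `mirror_onAxis` — CUSPIDALITY IS LOAD-BEARING in the lever
  `UnitaryMirror`: the Harish-Chandra parameter `{s, -s}` (at `ι` and at `ῑ`) of the spherical Eisenstein
  datum `|·|_ℂ^{s} ⊞ |·|_ℂ^{-s}` on `GL₂` admits NO mirror constant once `Re s ≠ 0` and `Im s ≠ 0`, while
  on the axes (`Re s = 0`: tempered; `Im s = 0`: real exponents, e.g. the trivial representation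
  `s = 1/2`) it does — the mirror detects "unitary up to twist", not cuspidality, and not temperedness.
* `mirror_eq_purity_of_real`, `mirror_constant_integral` — on conj-fixed (e.g. integral) parameters the
  mirror map `z ↦ -z̄ + c` IS Clozel's purity map `z ↦ c - z`, and the constant is then an integer: the
  levers of lines `unitary-mirror-parity` (mirror) and `multiset-purity-parity` (multiset purity) coincide
  embedding by embedding on C-algebraic `GL₃` parameters; neither composition uses the uniformity of the
  constant in `ι` (which is Weil's parallelism of real parts).
* `sqrt_trivial_on_squares` — the mechanism of `stub_centralSquareRoot` (line `unimodular-normal-form`)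
  over ANY number field: a pointwise square root `η` of `ω⁻¹` is trivial on the SQUARES of whatever
  subgroup `ω` is trivial on (Weil exponent `M ↦ 2M`; cf. `squares_trick`).
* `angular_trivial_on_realSquares` — the mechanism of `stub_angularRegulariserCM`: an angular character
  `(z/|z|)^A` is trivial on squares of REAL units (the `K⁺`-units of a CM field at a complex place).
* `eisensteinWitness_HC_regularIntegral` — the archimedean half of the Eisenstein witness showing that
  the two cuspidality hypotheses of the crux cannot BOTH be weakened to "automorphic".

None of these asserts a Theses statement (NEGATIVE LEMMAS rule). References: A. Knapp, D. Vogan,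
*Cohomological induction and unitary representations* (1995), Ch. IX §1 (Hermitian dual and infinitesimal
character); L. Clozel, *Motifs et formes automorphes* (1990), Lemme 4.9; H. Jacquet, J. Shalika, *On Euler
products and the classification of automorphic forms II* (1981), Thm. 4.4; A. Weil (1956).
-/

set_option linter.dupNamespace false

namespace Summit.Langlands.Langlands.Theorems.RegularTwistCM.Negative

open scoped BigOperators ComplexConjugate

/-- `n = 1` MIRROR ⟺ EQUAL IMAGINARY PARTS: for single exponents `s` (at `ι`) and `t` (at `ῑ`), a real
`c` with `{t} = {-s̄ + c}` exists iff `Im s = Im t` (and then `c = Re s + Re t`). [folklore] -/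
theorem mirror_glOne_iff (s t : ℂ) :
    (∃ c : ℝ, ({t} : Multiset ℂ) = ({s} : Multiset ℂ).map (fun z => -conj z + (c : ℂ))) ↔
      s.im = t.im := by
  constructor
  · rintro ⟨c, hc⟩
    rw [Multiset.map_singleton, Multiset.singleton_inj] at hc
    have := congrArg Complex.im hc
    simp at this
    linarith
  · intro h
    refine ⟨s.re + t.re, ?_⟩
    rw [Multiset.map_singleton, Multiset.singleton_inj]
    apply Complex.ext <;> simp [h]

/-- The pairing `s - t ∈ ℤ` of a character `z^s z̄^t` of `ℂˣ` gives the `n = 1` mirror for free: the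
lever `UnitaryMirror` of line `unitary-mirror-parity` has no content in rank one beyond the uniformity
of its constant. [folklore] -/
theorem mirror_glOne_of_pairing (s t : ℂ) (h : ∃ m : ℤ, s - t = m) :
    ∃ c : ℝ, ({t} : Multiset ℂ) = ({s} : Multiset ℂ).map (fun z => -conj z + (c : ℂ)) := by
  rw [mirror_glOne_iff]
  obtain ⟨m, hm⟩ := h
  have := congrArg Complex.im hm
  simp at this
  linarith

/-- OFF-AXIS EISENSTEIN PARAMETERS VIOLATE THE MIRROR (cuspidality is load-bearing in `UnitaryMirror`):
the rank-two parameter `{s, -s}`, equal at `ι` and `ῑ` — the Harish-Chandra parameter of the spherical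
Eisenstein datum `|·|_ℂ^{s} ⊞ |·|_ℂ^{-s}`, an automorphic but non-cuspidal Borel–Jacquet datum on `GL₂` —
is its own mirror image for NO real `c` as soon as `Re s ≠ 0` and `Im s ≠ 0`. [folklore] -/
theorem mirror_offAxis_obstructed (s : ℂ) (hre : s.re ≠ 0) (him : s.im ≠ 0) :
    ¬ ∃ c : ℝ, ({s, -s} : Multiset ℂ) = ({s, -s} : Multiset ℂ).map (fun z => -conj z + (c : ℂ)) := by
  rintro ⟨c, hc⟩
  simp only [Multiset.insert_eq_cons, Multiset.map_cons, Multiset.map_singleton, map_neg] at hc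
  rw [Multiset.cons_eq_cons] at hc
  rcases hc with ⟨h1, h2⟩ | ⟨-, cs, h2, -⟩
  · rw [Multiset.singleton_inj] at h2
    have e1 := congrArg Complex.re h1
    have e2 := congrArg Complex.re h2
    simp at e1 e2
    apply hre
    linarith
  · rw [Multiset.singleton_eq_cons_iff] at h2
    have e := congrArg Complex.im h2.1
    simp at e
    apply him
    linarith

/-- ON-AXIS PARAMETERS DO SATISFY THE MIRROR (tightness of `mirror_offAxis_obstructed`): for `Re s = 0`
(tempered Eisenstein data) or `Im s = 0` (real exponents; `s = 1/2` is the trivial representation of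
`GL₂`, `s ∈ (0, 1/2)` the complementary series) the parameter `{s, -s}` is its own mirror image with
`c = 0` — so the mirror certifies "unitary up to twist", NOT cuspidality and NOT temperedness. [folklore] -/
theorem mirror_onAxis (s : ℂ) (h : s.re = 0 ∨ s.im = 0) :
    ∃ c : ℝ, ({s, -s} : Multiset ℂ) = ({s, -s} : Multiset ℂ).map (fun z => -conj z + (c : ℂ)) := by
  refine ⟨0, ?_⟩
  simp only [Multiset.insert_eq_cons, Multiset.map_cons, Multiset.map_singleton,
    Complex.ofReal_zero, add_zero, map_neg]
  rcases h with h | h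
  · -- tempered (`Re s = 0`): `-conj s = s`, entry by entry
    have hs : conj s = -s := by apply Complex.ext <;> simp [h]
    rw [hs, neg_neg]
  · -- real exponents (`Im s = 0`): `-conj s = -s`, the two entries swap
    have hs : conj s = s := by apply Complex.ext <;> simp [h]
    rw [hs, neg_neg]
    exact Multiset.cons_swap s (-s) 0

/-- MIRROR = PURITY ON conj-FIXED PARAMETERS: if every element of `P` is real (e.g. an integer — the
C-algebraic case for `GL₃`), the mirror image `{-z̄ + c}` is Clozel's purity image `{c - z}`. Hence, at
ONE embedding, the lever of line `unitary-mirror-parity` and `stub_purity` of line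
`multiset-purity-parity` say the same thing about a regular algebraic `GL₃` parameter.
[cite: Clozel1990, Lemme 4.9] -/
theorem mirror_eq_purity_of_real {P : Multiset ℂ} (hP : ∀ z ∈ P, conj z = z) (c : ℂ) :
    P.map (fun z => -conj z + c) = P.map (fun z => c - z) := by
  refine Multiset.map_congr rfl fun z hz => ?_
  rw [hP z hz]
  ring

/-- … and the mirror/purity constant is then an INTEGER: if `P` is non-empty and integral and its image
`{c - z}` is integral too, then `c ∈ ℤ` (the purity weight `w`). [cite: Clozel1990, Lemme 4.9] -/
theorem mirror_constant_integral {P Q : Multiset ℂ} {c : ℂ} (hP : ∀ z ∈ P, ∃ k : ℤ, z = k)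
    (hQ : ∀ z ∈ Q, ∃ k : ℤ, z = k) (hne : P ≠ 0) (h : Q = P.map (fun z => c - z)) :
    ∃ w : ℤ, c = w := by
  obtain ⟨z, hz⟩ := Multiset.exists_mem_of_ne_zero hne
  obtain ⟨k, rfl⟩ := hP z hz
  have hmem : c - (k : ℂ) ∈ Q := by
    rw [h]
    exact Multiset.mem_map_of_mem _ hz
  obtain ⟨l, hl⟩ := hQ _ hmem
  exact ⟨l + k, by push_cast; linear_combination hl⟩

/-- SQUARE ROOTS LIVE ON SQUARES (the mechanism of `stub_centralSquareRoot` of line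
`unimodular-normal-form`, over ANY number field): if `ω` is trivial on a subgroup `V` (of the units) and
`η² = ω⁻¹` pointwise, then `η` is trivial on `V² = {u² : u ∈ V}` — Weil's exponent doubles, nothing else
is needed globally (locally the half exponents need `e ι - e ῑ` even; at a real place the sign character
is invisible to Harish-Chandra parameters). [cite: Weil1956, unit criterion] -/
theorem sqrt_trivial_on_squares {U M : Type*} [CommGroup U] [CommGroup M] (ω η : U →* M)
    (V : Subgroup U) (hω : ∀ u ∈ V, ω u = 1) (hη : ∀ u, η u ^ 2 = (ω u)⁻¹) {u : U} (hu : u ∈ V) :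
    η (u ^ 2) = 1 := by
  rw [map_pow, hη, hω u hu, inv_one]

/-- ANGULAR CHARACTERS DIE ON REAL SQUARES (the mechanism of `stub_angularRegulariserCM` of line
`unimodular-normal-form`): for a non-zero REAL `u` — a `K⁺`-unit seen at a complex place of the CM field
`K` — and any `A`, `(u²/|u²|)^A = 1`; so `∏_w (z_w/|z_w|)^{A_w}` is trivial on the squares of the
(finite-index) real units, for EVERY choice of the exponents `A_w` (mixed parities across places
included). Off CM this fails: at a complex place of a non-CM field the unit arguments are not killed on
any finite-index subgroup (Patrikis, Lemma 2.1.5(1)). [cite: Patrikis2019, Lemma 2.1.5] -/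
theorem angular_trivial_on_realSquares (u : ℝ) (hu : u ≠ 0) (A : ℕ) :
    ((((u : ℂ) ^ 2) / ((‖(u : ℂ) ^ 2‖ : ℝ) : ℂ)) ^ A) = 1 := by
  have hpos : (0 : ℝ) < u ^ 2 := by positivity
  have h2 : ((u : ℂ) ^ 2) = ((u ^ 2 : ℝ) : ℂ) := by push_cast; ring
  rw [h2, Complex.norm_real, Real.norm_of_nonneg hpos.le, div_self, one_pow]
  exact_mod_cast hpos.ne'

/-- ARCHIMEDEAN HALF OF THE EISENSTEIN WITNESS (both cuspidality hypotheses of `RegularTwistCM` weakened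
to "automorphic" makes it FALSE): for `μ` a Hecke character of the CM field `K` of type `(z/|z|)²` at
every complex place (exponents `(1, -1)`) and `ν = 1`, the isobaric `π = μ ⊞ 𝟙 ⊞ μ⁻¹` on `GL₃` has
Harish-Chandra parameter `{1 + p, p, -1 + p}` (`p = 0`; any `p ∈ ℤ` after an algebraic twist) at every
embedding — integral and regular, i.e. regular C-algebraic for `GL₃`, of the adjoint shape
`{x - y + p, p, y - x + p}` with `x - y = 1` relative to `σ₀ = μ ⊞ 𝟙` on `GL₂`; but no CUSPIDAL `σ`
has the Eisenstein Satake parameters `c_v · {μ(ϖ_v), 1}` a.e. (Jacquet–Shalika II, Thm. 4.4).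
[cite: JacquetShalikaAJM1981II, Thm. 4.4] -/
theorem eisensteinWitness_HC_regularIntegral (p : ℤ) :
    (∀ z ∈ ({(1 : ℂ) + p, (p : ℂ), -1 + (p : ℂ)} : Multiset ℂ), ∃ k : ℤ, z = k) ∧
      ({(1 : ℂ) + p, (p : ℂ), -1 + (p : ℂ)} : Multiset ℂ).Nodup := by
  refine ⟨?_, ?_⟩
  · intro z hz
    simp only [Multiset.insert_eq_cons, Multiset.mem_cons, Multiset.mem_singleton] at hz
    rcases hz with rfl | rfl | rfl
    · exact ⟨1 + p, by push_cast; ring⟩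
    · exact ⟨p, rfl⟩
    · exact ⟨-1 + p, by push_cast; ring⟩
  · simp only [Multiset.insert_eq_cons, Multiset.nodup_cons, Multiset.mem_cons,
      Multiset.mem_singleton, Multiset.nodup_singleton, and_true, not_or]
    refine ⟨⟨?_, ?_⟩, ?_⟩ <;>
    · intro h
      have := congrArg Complex.re h
      simp at this
      try linarith

end Summit.Langlands.Langlands.Theorems.RegularTwistCM.Negative
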